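import Summits.QuantumFields.YangMills.Theorems.BalabanUVNodesN11Sect3SupplyChainZero
import Summits.QuantumFields.YangMills.Theorems.BalabanUVNodesN11RStepWitnessDefs

/-!
# DAG node N11 — def-T's OPERAND ROWS ALONG THE WITNESS CHAIN FROM THE SUPPLIER's OWN TERM ROWS: `SupplierTermRows θ p σ → OperandRowsAlongChain θ p σ`, hence THEOREM 1
# OF [III] from `SupplierObligations` + the witness-free `ResidualRows` (or a Gaussian certificate) + the supplier's term rows [+ `RStepW`] — everything on the supplier's side a
# property of ITS OWN terms

HEADER — WORK-UNIT METADATA.  Cell `pub-ymgap`, YM-PLAN Track A (HUMAN RULING D-0062 ∕ D-0149 width seats), seat `pub-ymgap-dag-n11-w3` (g2; WIDTH SEAT 3∕4 on NODE n11 [B14],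
director-ym №197), route `BalabanUVNodes` (v1.7 `CoPH` key), item K1⁷ `StabilityBAtRecordR13SepCoPH` = stmt-QuantumFields-20542 (DEFINITION lane `--kind definition --supports 20542
--as helper`, count-neutral).  THE ITEM: dag-n11-e g16's HAND-OUT «W3-Z1 — OPERAND ROWS ALONG THE CHAIN FROM THE SUPPLIER's TERM ROWS» (cell bus 2026-08-28 ≈02:29Z).
[III] = [Balaban1988Convergent], [IV] = [Balaban1989LargeFieldI].  Over dag-n11-d's p584440 `…OperandRowsOfTermRows` (`measurable_sect2Operand_of_termRows`,
`exists_bound_sect2Operand_of_termBounds`, rows for ALL levels `j`) + p585753 (`measurable_UbgOfRecord₁₃CoP`), dag-n08-w2's p586913 (`sect2Operand_congr_of_agree_pos`), dag-n11-e's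
p591185 ∕ p595576 ∕ p596032 ∕ p597757 (`spliceTermsB`, `chainWitness`, the graft selectors; `OperandRowsAt ∕ OperandRowsAlongChain`, `SupplierObligations`, `ResidualRows`;
`sLaw₁₃CoPH_all_of_obligations_of_rows ∕ _of_gaussCert`; `zeroSupplier` — the pattern of this file) and this seat's p597488 (`RStepW` twins).

WHY THIS FILE.  Along the chain road N11's hand-over list is WITNESS-KEYED (p592483 ∕ p595576) except def-T's two OPERAND ROWS `OperandRowsAlongChain θ p σ` (the §2 operand
`exp A_k[chain witness]` measurable on the multiscale configuration space and bounded above, at the no-expansion histories with a present parent) — rows about ITERATED SPLICES.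
dag-n11-d's `…OperandRowsOfTermRows` reduces them to rows on the TERM VALUES (E-, R-, B-row: measurability at the embedded background, 𝐁 jointly with the fluctuation datum; uniform
bounds) plus def-R's measurable background map.  THIS FILE pushes those term rows through the splice to the SUPPLIER's OWN RESPONSES (`SupplierTermRows θ p σ`).  Two facts: (i) the
splice SELECTS values pointwise (at `j ≤ k` from the old witness — its `𝐁^{(k)}` cut or re-supplied at the 𝐓-absent ∕ 𝐓-present children — above `k` from the response or zero), so
the rows pass through it level by level (§3) and along the chain every level `1 ≤ j ≤ k` of the level-`k` witness carries them (§4; the opaque level-`0` terms of def-T's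
`baseWitness` are never claimed); (ii) (2.23) at index `k` reads the levels `1 … k` only, so the operand of the chain witness equals the operand of its TRUNCATION to those levels
(zero elsewhere), to which dag-n11-d's all-level lemmas apply with trivial rows off `[1, k]` (§5) — no `1 ≤ j` re-edition of their lemmas, no stop-gap row on the base witness.

WHAT THIS FILE DECLARES ∕ PROVES (2 `def` with explicit binders — predicates with parameters naming displayed hypotheses, NOTHING CLAIMED for any `θ`; 0 `sorry`; standard axioms).
§1 `def TermRowsAt θ p t₀ j` (E ∕ R ∕ B measurability rows + one bound each, for ONE term value at ONE level) · `def SupplierTermRows θ p σ` · `supplierTermRows_iff`.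
§2 TRANSFER: `termRowsAt_of_eq` (rows pass along pointwise equalities, part by part from up to three sources) · `termRowsAt_zero` · `exists_uniform_bound` (per-level bounds, zero
   above `k` ⇒ one bound).
§3 ★ `termRowsAt_spliceTermsB` — the rows pass through ONE splice: level `j` of `spliceTermsB θ p k t tnew s′` has the rows if the old witness has them at `j` (when `j ≤ k`) and the
   response has them at `j` (when `k ≤ j`) — the three cases of the splice × the three level ranges.
§4 ★★ `termRowsAt_chainWitness_of_supplierTermRows` — along the chain, every level `1 ≤ j ≤ k` of the level-`k` witness has the rows (induction on `k`; base vacuous).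
§5 ★★ `operandRowsAt_of_termRows` (rows at the levels `1 … k` of ONE witness value ⇒ `OperandRowsAt`, via the truncation and (2.23)'s level range) · ★★★
   `operandRowsAlongChain_of_supplierTermRows : SupplierTermRows θ p σ → OperandRowsAlongChain θ p σ` · A6 `supplierTermRows_zeroSupplier` (inhabited: the zero supplier).
§6 THEOREM 1 OF [III] with the operand rows DISCHARGED from the supplier's term rows: ★★★ `sLaw₁₃CoPH_all_of_obligations_of_residualRows_of_supplierTermRows` (live-selector line:
   `SupplierObligations` + `ResidualRows` + `SupplierTermRows`) · ★★ `sLaw₁₃CoPH_all_of_obligations_of_gaussCert_of_supplierTermRows` (any Gaussian-class `θ`: `SupplierObligations` +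
   `SupplierTermRows`, NOTHING of the no-expansion lane) · the generic-`θ` twins under the 𝐑-side token: `RStepW.sLaw₁₃CoPH_all_of_obligations_of_residualRows_of_supplierTermRows` ·
   `RStepW.sLaw₁₃CoPH_all_of_obligations_of_gaussCert_of_supplierTermRows`.

HONEST FRAMING.  Count-neutral KERNEL BOOKKEEPING (measurability ∕ bounds transfer through pointwise selections; one level-range identity); `SupplierTermRows`, `SupplierObligations`,
`ResidualRows`, `RStepW` are DISPLAYED hypotheses (the first inhabited by the zero supplier, §5); nothing of Bałaban is asserted; N11 is NOT discharged; K1⁷ is NOT closed; counts unmoved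
(typed 28∕28 · discharged 5∕27).  One finite `𝕋⁴_{L^K}` programme at fixed `ε = L^{−K}`; R4 closes only the conditional finite-𝕋⁴ rung `BalabanLadder.UV` — NOT ℝ⁴, NOT OS, NOT a mass
gap, NOT Clay.  No `sorry`, no `axiom`, no `instance`, no `notation`.
Sources: [III] Theorem p.245, Thm 1 p.262, §2 p.262, §3 p.279, (3.1) p.264, (3.16)–(3.21) pp.268–269, (3.24)–(3.25) p.270, (2.18) p.257, (2.20)–(2.27) pp.258–259, (2.30)–(2.31) p.260,
(2.40)–(2.42) p.261; [IV] (0.2)–(0.4) p.176.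
-/

noncomputable section

open MeasureTheory
open scoped BigOperators ENNReal NNReal Matrix.Norms.L2Operator

namespace Summit.QuantumFields.YangMills.Theorems.BalabanUVNodesN11Sect3SupplyChainTermRows

open Literature.MathematicalPhysics.QuantumFieldTheory.Balaban1983to89 T4Continuum T4NestedCovariance Node00 Node00.Tk
open B15DeterminingSets B14.Eq225Concrete
open B10Eq42TorusConstraint (bondsIn)
open BalabanUVNodesN11HistoryPinnedResidualDefs (ZhPinOfRecord₁₃)
open BalabanUVNodesN11FluctTruncationDefs (IsFluctLocal)
open BalabanUVNodesN11Sect3SupplySpliceDefs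
open BalabanUVNodesN11Sect3SupplySpliceOwnBoundary (graftAboveB graftAboveB_E_of_le graftAboveB_R_of_le graftAboveB_B_of_lt graftAboveB_B_of_le graftAboveB_E_of_lt
  graftAboveB_R_of_lt)
open BalabanUVNodesN11Sect3SupplyChainDefs
open BalabanUVNodesN11Sect3SupplyChainObligationsDefs
open BalabanUVNodesN11Sect3SupplyChainNode (sLaw₁₃CoPH_all_of_obligations_of_rows sLaw₁₃CoPH_all_of_obligations_of_gaussCert)
open BalabanUVNodesN11Sect3SupplyChainZero (zeroSupplier zeroSupplier_fst)
open BalabanUVNodesN11FirstStepSupply (sect2Operand_congr_of_agree_pos)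
open BalabanUVNodesN11OperandRowsOfTermRows (measurable_sect2Operand_of_termRows exists_bound_sect2Operand_of_termBounds)
open BalabanUVNodesN11BackgroundCoPMeasurable (measurable_UbgOfRecord₁₃CoP)
open BalabanUVNodesN11RStepWitnessDefs (RStepW)

variable {F : T4Family} {N : ℕ} [NeZero N]

/-! ## §1. The term rows of one term value at one level; the supplier's term rows -/

section Defs

/-- **THE TERM ROWS OF ONE TERM VALUE `t₀` AT ONE LEVEL `j`** (dag-n11-d's E-row ∕ R-row ∕ B-row of `…OperandRowsOfTermRows`, at the level `j`, with one bound per row): read at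
the embedded background `ι U` of the setting of record, `U ↦ Re 𝐄^{(j)}(X, ι U, z; g′)` and `U ↦ Re 𝐑^{(j)}(X, ι U)` are measurable, `(U, A) ↦ Re 𝐁^{(j)}(X, ι U, ({S′_i}, A))` is
jointly measurable for every old-branch datum `{S′_i}`, and each family is uniformly bounded.  A PREDICATE WITH PARAMETERS naming a displayed hypothesis on term values (a
measurability ∕ bound law — def-T's `Sect2.TermValues` carries no such law); NOTHING is claimed for any `θ`. [cite: Balaban1988Convergent, (2.23)–(2.27) pp.258–259, (2.30)–(2.31) p.260, (2.40)–(2.41) p.261, (3.16)–(3.21) pp.268–269 (bookkeeping)] -/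
def TermRowsAt (θ : Stage13HParams F N) (p : B12.RunParams) (t₀ : Sect2.TermValues (F.P p.K) (MatA N) (FluctV N) θ.τ9.M) (j : ℕ) : Prop :=
  (∀ (X : (Sect2.domSys (F.P p.K) θ.τ9.M j).Dom) (z : Site (F.P p.K) j) (g' : ℝ),
      Measurable (fun U : GaugeField (F.P p.K) 0 (SU N) => (t₀.E j X z g' (Sect2.ofBackgroundC (settingOfRecord₁₃ F N θ.toStage13Params p).ι U)).re)) ∧
  (∃ CE : ℝ, ∀ (X : (Sect2.domSys (F.P p.K) θ.τ9.M j).Dom) (z : Site (F.P p.K) j) (g' : ℝ) (U : GaugeField (F.P p.K) 0 (SU N)),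
      |(t₀.E j X z g' (Sect2.ofBackgroundC (settingOfRecord₁₃ F N θ.toStage13Params p).ι U)).re| ≤ CE) ∧
  (∀ X : (Sect2.domSys (F.P p.K) θ.τ9.M j).Dom,
      Measurable (fun U : GaugeField (F.P p.K) 0 (SU N) => (t₀.R j X (Sect2.ofBackgroundC (settingOfRecord₁₃ F N θ.toStage13Params p).ι U)).re)) ∧
  (∃ CR : ℝ, ∀ (X : (Sect2.domSys (F.P p.K) θ.τ9.M j).Dom) (U : GaugeField (F.P p.K) 0 (SU N)),
      |(t₀.R j X (Sect2.ofBackgroundC (settingOfRecord₁₃ F N θ.toStage13Params p).ι U)).re| ≤ CR) ∧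
  (∀ (S' : ℕ → Set (Site (F.P p.K) 0)) (X : (Sect2.domSys (F.P p.K) θ.τ9.M j).Dom),
      Measurable (fun q : GaugeField (F.P p.K) 0 (SU N) × MSFluct (F.P p.K) (FluctV N) =>
        (t₀.B j X (Sect2.ofBackgroundC (settingOfRecord₁₃ F N θ.toStage13Params p).ι q.1) (S', q.2)).re)) ∧
  (∃ CB : ℝ, ∀ (X : (Sect2.domSys (F.P p.K) θ.τ9.M j).Dom) (U : GaugeField (F.P p.K) 0 (SU N)) (a : Tk.SFluct (F.P p.K) (FluctV N)),
      |(t₀.B j X (Sect2.ofBackgroundC (settingOfRecord₁₃ F N θ.toStage13Params p).ι U) a).re| ≤ CB)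

/-- **THE SUPPLIER's TERM ROWS ALONG ITS OWN CHAIN**: every response `σ k (chain witness at k)` has, at every history `s′` of length `k+1` and every level `1 ≤ j`, the term rows
`TermRowsAt` — a property of the supplier's OWN constructed terms (the response matters at the levels `k` (its re-issued `𝐁^{(k)}`) and `k+1` (the new terms); elsewhere a supplier may
carry zeros).  The sixth witness-keyed family of N11's hand-over list (after p595576's five); NOTHING claimed for any `θ` — inhabited by the zero supplier (§5).
[cite: Balaban1988Convergent, §3 p.279, (3.24)–(3.25) p.270, (2.27) p.259, (2.31) p.260, (2.41) p.261 (bookkeeping)] -/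
def SupplierTermRows (θ : Stage13HParams F N) (p : B12.RunParams) (σ : Sect3Supplier θ p) : Prop :=
  ∀ (k : ℕ) (s : SeqOfRecord F θ.ν θ.τ9.M (gOfRecord₁₃ F N θ.toStage13Params p) p.K (k + 1)) (j : ℕ), 1 ≤ j →
    TermRowsAt θ p ((σ k (chainWitness θ p σ k).1 (chainWitness θ p σ k).2).1 s) j

variable (θ : Stage13HParams F N) (p : B12.RunParams)

/-- `SupplierTermRows` unfolds to «every response has the term rows at every level `1 ≤ j`» (`Iff.rfl`). [cite: Balaban1988Convergent, §3 p.279 (bookkeeping)] -/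
theorem supplierTermRows_iff (σ : Sect3Supplier θ p) :
    SupplierTermRows θ p σ ↔
      ∀ (k : ℕ) (s : SeqOfRecord F θ.ν θ.τ9.M (gOfRecord₁₃ F N θ.toStage13Params p) p.K (k + 1)) (j : ℕ), 1 ≤ j →
        TermRowsAt θ p ((σ k (chainWitness θ p σ k).1 (chainWitness θ p σ k).2).1 s) j := Iff.rfl

end Defs

/-! ## §2. Transfer lemmas: the rows pass along pointwise equalities; zero term values; one bound from per-level bounds -/

section Transfer

variable {θ : Stage13HParams F N} {p : B12.RunParams}

/-- **THE ROWS PASS ALONG POINTWISE EQUALITIES, PART BY PART**: if at the level `j` the 𝐄 of `t′` is the 𝐄 of `t₁`, the 𝐑 of `t′` that of `t₂`, the 𝐁 of `t′` that of `t₃`, and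
`t₁, t₂, t₃` have the rows at `j`, then `t′` has them (measurability and bounds of literally the same functions). [cite: Balaban1988Convergent, (2.23) p.258 (bookkeeping)] -/
theorem termRowsAt_of_eq {t' t₁ t₂ t₃ : Sect2.TermValues (F.P p.K) (MatA N) (FluctV N) θ.τ9.M} {j : ℕ}
    (hE : ∀ (X : (Sect2.domSys (F.P p.K) θ.τ9.M j).Dom) (z : Site (F.P p.K) j) (g' : ℝ) (φ : Sect2.CPair (F.P p.K) (MatA N)), t'.E j X z g' φ = t₁.E j X z g' φ)
    (hR : ∀ (X : (Sect2.domSys (F.P p.K) θ.τ9.M j).Dom) (φ : Sect2.CPair (F.P p.K) (MatA N)), t'.R j X φ = t₂.R j X φ)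
    (hB : ∀ (X : (Sect2.domSys (F.P p.K) θ.τ9.M j).Dom) (φ : Sect2.CPair (F.P p.K) (MatA N)) (a : Tk.SFluct (F.P p.K) (FluctV N)), t'.B j X φ a = t₃.B j X φ a)
    (h₁ : TermRowsAt θ p t₁ j) (h₂ : TermRowsAt θ p t₂ j) (h₃ : TermRowsAt θ p t₃ j) : TermRowsAt θ p t' j := by
  obtain ⟨hmE, ⟨CE, hbE⟩, -, -, -, -⟩ := h₁
  obtain ⟨-, -, hmR, ⟨CR, hbR⟩, -, -⟩ := h₂
  obtain ⟨-, -, -, -, hmB, ⟨CB, hbB⟩⟩ := h₃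
  refine ⟨fun X z g' => ?_, ⟨CE, fun X z g' U => ?_⟩, fun X => ?_, ⟨CR, fun X U => ?_⟩, fun S' X => ?_, ⟨CB, fun X U a => ?_⟩⟩
  · simp only [hE]; exact hmE X z g'
  · rw [hE]; exact hbE X z g' U
  · simp only [hR]; exact hmR X
  · rw [hR]; exact hbR X U
  · simp only [hB]; exact hmB S' X
  · rw [hB]; exact hbB X U a

/-- **ZERO TERM VALUES HAVE THE ROWS AT EVERY LEVEL** (constants; bound `0`). [cite: Balaban1988Convergent, Thm 1 p.262 (bookkeeping)] -/
theorem termRowsAt_zero (j : ℕ) : TermRowsAt θ p (Sect2.TermValues.zero : Sect2.TermValues (F.P p.K) (MatA N) (FluctV N) θ.τ9.M) j :=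
  ⟨fun _ _ _ => measurable_const, ⟨0, fun _ _ _ _ => by simp [Sect2.TermValues.zero]⟩, fun _ => measurable_const, ⟨0, fun _ _ => by simp [Sect2.TermValues.zero]⟩,
    fun _ _ => measurable_const, ⟨0, fun _ _ _ => by simp [Sect2.TermValues.zero]⟩⟩

/-- **ONE BOUND FROM PER-LEVEL BOUNDS**: a family `f j` (with level-dependent arguments) bounded at every level and vanishing above the level `k` is uniformly bounded (by
`∑_{i ≤ k} |C_i|`). [folklore] -/
theorem exists_uniform_bound {X : ℕ → Sort*} {f : (j : ℕ) → X j → ℝ} (k : ℕ) (hb : ∀ j, ∃ C : ℝ, ∀ x, |f j x| ≤ C) (hz : ∀ j, k < j → ∀ x, f j x = 0) :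
    ∃ C : ℝ, ∀ j x, |f j x| ≤ C := by
  choose C hC using hb
  refine ⟨∑ i ∈ Finset.range (k + 1), |C i|, fun j x => ?_⟩
  by_cases hj : j ≤ k
  · exact (hC j x).trans ((le_abs_self _).trans
      (Finset.single_le_sum (f := fun i => |C i|) (fun i _ => abs_nonneg (C i)) (Finset.mem_range.2 (Nat.lt_succ_of_le hj))))
  · rw [hz j (not_le.mp hj) x, abs_zero]
    exact Finset.sum_nonneg fun i _ => abs_nonneg (C i)

end Transfer

/-! ## §3. The rows pass through one splice -/

section Splice

variable {θ : Stage13HParams F N} {p : B12.RunParams}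

/-- **★ THE TERM ROWS PASS THROUGH ONE SPLICE, LEVEL BY LEVEL**: the level-`j` rows of `spliceTermsB θ p k t tnew s′` follow from the level-`j` rows of the old witness value
`t (init s′)` (needed when `j ≤ k`) and of the response `tnew s′` (needed when `k ≤ j`).  The splice SELECTS values pointwise: at a no-expansion history `graftAbove k (t (init s′))
(zeroRB (tnew s′))` (levels `≤ k` old; above `k` the response's 𝐄, zero `𝐑 ∕ 𝐁`); at a 𝐓-absent expansion child `graftAbove k (dropBFrom k (t (init s′))) (zeroRB (tnew s′))` (the
old `𝐁^{(k)}` cut to zero); at a 𝐓-present one `graftAboveB k (t (init s′)) (tnew s′)` (the response's `𝐁` from the level `k` on) — §2's transfer in each of the nine sub-cases.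
[cite: Balaban1988Convergent, §2 p.262, §3 p.279, (3.24)–(3.25) p.270, (3.1) p.264, (2.40)–(2.41) p.261 (bookkeeping)] -/
theorem termRowsAt_spliceTermsB (k : ℕ) (t : SeqOfRecord F θ.ν θ.τ9.M (gOfRecord₁₃ F N θ.toStage13Params p) p.K k → Sect2.TermValues (F.P p.K) (MatA N) (FluctV N) θ.τ9.M)
    (tnew : SeqOfRecord F θ.ν θ.τ9.M (gOfRecord₁₃ F N θ.toStage13Params p) p.K (k + 1) → Sect2.TermValues (F.P p.K) (MatA N) (FluctV N) θ.τ9.M)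
    (s : SeqOfRecord F θ.ν θ.τ9.M (gOfRecord₁₃ F N θ.toStage13Params p) p.K (k + 1)) (j : ℕ)
    (hold : j ≤ k → TermRowsAt θ p (t s.init) j) (hnew : k ≤ j → TermRowsAt θ p (tnew s) j) :
    TermRowsAt θ p (spliceTermsB θ p k t tnew s) j := by
  have hz : TermRowsAt θ p (Sect2.TermValues.zero : Sect2.TermValues (F.P p.K) (MatA N) (FluctV N) θ.τ9.M) j := termRowsAt_zero j
  by_cases hjk : j ≤ k
  · have ho := hold hjk
    by_cases hΩ : s.Ω (k + 1) = ∅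
    · rw [spliceTermsB_of_Omega_empty _ _ s hΩ]
      exact termRowsAt_of_eq (fun X z g' φ => graftAbove_E_of_le _ _ hjk X z g' φ) (fun X φ => graftAbove_R_of_le _ _ hjk X φ)
        (fun X φ a => graftAbove_B_of_le _ _ hjk X φ a) ho ho ho
    by_cases h0 : slotsTOfRecord F N θ.ν θ.τ9 (EOfRecord₁₃ F N θ.toStage13Params) (wOfRecord₉ F N θ.toStage9Params) θ.ppSel p
        (gOfRecord₁₃ F N θ.toStage13Params p) (k + 1) s = 0
    · rw [spliceTermsB_of_absent _ _ s hΩ h0]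
      by_cases hjk' : j < k
      · exact termRowsAt_of_eq (t₁ := t s.init) (t₂ := t s.init) (fun X z g' φ => by rw [graftAbove_E_of_le _ _ hjk]; rfl)
          (fun X φ => by rw [graftAbove_R_of_le _ _ hjk]; rfl) (fun X φ a => by rw [graftAbove_B_of_le _ _ hjk, dropBFrom_B_of_lt _ hjk']) ho ho ho
      · exact termRowsAt_of_eq (t₁ := t s.init) (t₂ := t s.init) (t₃ := Sect2.TermValues.zero) (fun X z g' φ => by rw [graftAbove_E_of_le _ _ hjk]; rfl)
          (fun X φ => by rw [graftAbove_R_of_le _ _ hjk]; rfl)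
          (fun X φ a => by rw [graftAbove_B_of_le _ _ hjk, dropBFrom_B_of_le _ (not_lt.mp hjk')]; rfl) ho ho hz
    · rw [spliceTermsB_of_present _ _ s hΩ h0]
      by_cases hjk' : j < k
      · exact termRowsAt_of_eq (fun X z g' φ => graftAboveB_E_of_le _ _ hjk X z g' φ) (fun X φ => graftAboveB_R_of_le _ _ hjk X φ)
          (fun X φ a => graftAboveB_B_of_lt _ _ hjk' X φ a) ho ho ho
      · exact termRowsAt_of_eq (fun X z g' φ => graftAboveB_E_of_le _ _ hjk X z g' φ) (fun X φ => graftAboveB_R_of_le _ _ hjk X φ)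
          (fun X φ a => graftAboveB_B_of_le _ _ (not_lt.mp hjk') X φ a) ho ho (hnew (not_lt.mp hjk'))
  · have hjk' : k < j := not_le.mp hjk
    have hn := hnew hjk'.le
    by_cases hΩ : s.Ω (k + 1) = ∅
    · rw [spliceTermsB_of_Omega_empty _ _ s hΩ]
      exact termRowsAt_of_eq (t₂ := Sect2.TermValues.zero) (t₃ := Sect2.TermValues.zero) (fun X z g' φ => by rw [graftAbove_E_of_lt _ _ hjk']; rfl)
        (fun X φ => by rw [graftAbove_R_of_lt _ _ hjk']; rfl) (fun X φ a => by rw [graftAbove_B_of_lt _ _ hjk']; rfl) hn hz hz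
    by_cases h0 : slotsTOfRecord F N θ.ν θ.τ9 (EOfRecord₁₃ F N θ.toStage13Params) (wOfRecord₉ F N θ.toStage9Params) θ.ppSel p
        (gOfRecord₁₃ F N θ.toStage13Params p) (k + 1) s = 0
    · rw [spliceTermsB_of_absent _ _ s hΩ h0]
      exact termRowsAt_of_eq (t₂ := Sect2.TermValues.zero) (t₃ := Sect2.TermValues.zero) (fun X z g' φ => by rw [graftAbove_E_of_lt _ _ hjk']; rfl)
        (fun X φ => by rw [graftAbove_R_of_lt _ _ hjk']; rfl) (fun X φ a => by rw [graftAbove_B_of_lt _ _ hjk']; rfl) hn hz hz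
    · rw [spliceTermsB_of_present _ _ s hΩ h0]
      exact termRowsAt_of_eq (fun X z g' φ => graftAboveB_E_of_lt _ _ hjk' X z g' φ) (fun X φ => graftAboveB_R_of_lt _ _ hjk' X φ)
        (fun X φ a => graftAboveB_B_of_le _ _ hjk'.le X φ a) hn hn hn

end Splice

/-! ## §4. Along the chain every level `1 ≤ j ≤ k` of the level-`k` witness carries the rows -/

section Chain

variable {θ : Stage13HParams F N} {p : B12.RunParams}

/-- **★★ ALONG THE CHAIN, EVERY LEVEL `1 ≤ j ≤ k` OF THE LEVEL-`k` WITNESS HAS THE TERM ROWS** when the supplier's responses have them (`SupplierTermRows θ p σ`): induction on `k`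
over the splice (§3) — at `k+1`, the level `j ≤ k` is served by the inductive hypothesis at `init s′` (and, for the re-issued `𝐁^{(k)}` at `j = k`, by the response), the level
`k+1` by the response; the base `k = 0` is VACUOUS (no level `1 ≤ j ≤ 0`) — the opaque terms of def-T's `baseWitness` are never claimed.
[cite: Balaban1988Convergent, §3 p.279, (3.24)–(3.25) p.270, (2.25) p.259, (2.30) p.260, (2.40) p.261 (bookkeeping)] -/
theorem termRowsAt_chainWitness_of_supplierTermRows {σ : Sect3Supplier θ p} (hσ : SupplierTermRows θ p σ) :
    ∀ (k : ℕ) (s : SeqOfRecord F θ.ν θ.τ9.M (gOfRecord₁₃ F N θ.toStage13Params p) p.K k) (j : ℕ), 1 ≤ j → j ≤ k →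
      TermRowsAt θ p ((chainWitness θ p σ k).1 s) j := by
  intro k
  induction k with
  | zero => intro s j h1 h0; omega
  | succ k ih =>
    intro s j h1 _
    exact termRowsAt_spliceTermsB k (chainWitness θ p σ k).1 _ s j (fun hjk => ih s.init j h1 hjk) fun _ => hσ k s j h1

end Chain

/-! ## §5. The operand rows: one witness value from its rows at the levels `1 … k`; along the chain from the supplier's term rows -/

section Operand

variable (θ : Stage13HParams F N) (p : B12.RunParams)

/-- **★★ `OperandRowsAt θ p k s′ t₀ E₀` FROM THE TERM ROWS OF `t₀` AT THE LEVELS `1 ≤ j ≤ k` ONLY.**  (2.23) at index `k` reads those levels only (dag-n08-w2's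
`sect2Operand_congr_of_agree_pos`), so the operand of `t₀` IS the operand of its truncation `graftAbove 0 0 (graftAbove k t₀ 0)` (zero at `j = 0` and above `k`); that truncation has
dag-n11-d's ALL-level term rows (the given ones on `[1, k]`, the zero rows elsewhere, one bound by `exists_uniform_bound`), whence `measurable_sect2Operand_of_termRows` (with def-R's
`measurable_UbgOfRecord₁₃CoP`) and `exists_bound_sect2Operand_of_termBounds`. [cite: Balaban1988Convergent, (2.18) p.257, (2.20)–(2.25) pp.258–259, (2.30) p.260, (2.40) p.261, (3.16)–(3.21) pp.268–269] -/
theorem operandRowsAt_of_termRows (k : ℕ) (s : SeqOfRecord F θ.ν θ.τ9.M (gOfRecord₁₃ F N θ.toStage13Params p) p.K (k + 1))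
    (t₀ : Sect2.TermValues (F.P p.K) (MatA N) (FluctV N) θ.τ9.M) (E₀ : ℝ) (hrows : ∀ j, 1 ≤ j → j ≤ k → TermRowsAt θ p t₀ j) :
    OperandRowsAt θ p k s t₀ E₀ := by
  intro S hS
  -- the truncation of `t₀` to the levels `1 … k`
  set tr : Sect2.TermValues (F.P p.K) (MatA N) (FluctV N) θ.τ9.M := graftAbove 0 Sect2.TermValues.zero (graftAbove k t₀ Sect2.TermValues.zero) with htr
  -- it agrees with `t₀` on `[1, k]` …
  have hagE : ∀ j, 1 ≤ j → j ≤ k → ∀ (X : (Sect2.domSys (F.P p.K) θ.τ9.M j).Dom) (z : Site (F.P p.K) j) (gc : ℝ) (φ : Sect2.CPair (F.P p.K) (MatA N)),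
      tr.E j X z gc φ = t₀.E j X z gc φ := fun j h1 hj X z gc φ => by
    rw [htr, graftAbove_E_of_lt _ _ (Nat.lt_of_lt_of_le Nat.zero_lt_one h1), graftAbove_E_of_le _ _ hj]
  have hagR : ∀ j, 1 ≤ j → j ≤ k → ∀ (X : (Sect2.domSys (F.P p.K) θ.τ9.M j).Dom) (φ : Sect2.CPair (F.P p.K) (MatA N)), tr.R j X φ = t₀.R j X φ := fun j h1 hj X φ => by
    rw [htr, graftAbove_R_of_lt _ _ (Nat.lt_of_lt_of_le Nat.zero_lt_one h1), graftAbove_R_of_le _ _ hj]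
  have hagB : ∀ j, 1 ≤ j → j ≤ k → ∀ (X : (Sect2.domSys (F.P p.K) θ.τ9.M j).Dom) (φ : Sect2.CPair (F.P p.K) (MatA N)) (a : Tk.SFluct (F.P p.K) (FluctV N)),
      tr.B j X φ a = t₀.B j X φ a := fun j h1 hj X φ a => by
    rw [htr, graftAbove_B_of_lt _ _ (Nat.lt_of_lt_of_le Nat.zero_lt_one h1), graftAbove_B_of_le _ _ hj]
  -- … and is ZERO off `[1, k]`
  have hzE : ∀ j, ¬ (1 ≤ j ∧ j ≤ k) → ∀ (X : (Sect2.domSys (F.P p.K) θ.τ9.M j).Dom) (z : Site (F.P p.K) j) (gc : ℝ) (φ : Sect2.CPair (F.P p.K) (MatA N)),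
      tr.E j X z gc φ = 0 := fun j hj X z gc φ => by
    by_cases h0 : j = 0
    · subst h0; rw [htr, graftAbove_E_of_le _ _ le_rfl]; rfl
    · have hjk : k < j := by omega
      rw [htr, graftAbove_E_of_lt _ _ (Nat.pos_of_ne_zero h0), graftAbove_E_of_lt _ _ hjk]; rfl
  have hzR : ∀ j, ¬ (1 ≤ j ∧ j ≤ k) → ∀ (X : (Sect2.domSys (F.P p.K) θ.τ9.M j).Dom) (φ : Sect2.CPair (F.P p.K) (MatA N)), tr.R j X φ = 0 := fun j hj X φ => by
    by_cases h0 : j = 0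
    · subst h0; rw [htr, graftAbove_R_of_le _ _ le_rfl]; rfl
    · have hjk : k < j := by omega
      rw [htr, graftAbove_R_of_lt _ _ (Nat.pos_of_ne_zero h0), graftAbove_R_of_lt _ _ hjk]; rfl
  have hzB : ∀ j, ¬ (1 ≤ j ∧ j ≤ k) → ∀ (X : (Sect2.domSys (F.P p.K) θ.τ9.M j).Dom) (φ : Sect2.CPair (F.P p.K) (MatA N)) (a : Tk.SFluct (F.P p.K) (FluctV N)),
      tr.B j X φ a = 0 := fun j hj X φ a => by
    by_cases h0 : j = 0
    · subst h0; rw [htr, graftAbove_B_of_le _ _ le_rfl]; rfl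
    · have hjk : k < j := by omega
      rw [htr, graftAbove_B_of_lt _ _ (Nat.pos_of_ne_zero h0), graftAbove_B_of_lt _ _ hjk]; rfl
  -- hence the truncation has the rows at EVERY level
  have htrows : ∀ j, TermRowsAt θ p tr j := fun j => by
    by_cases hj : 1 ≤ j ∧ j ≤ k
    · exact termRowsAt_of_eq (hagE j hj.1 hj.2) (hagR j hj.1 hj.2) (hagB j hj.1 hj.2) (hrows j hj.1 hj.2) (hrows j hj.1 hj.2) (hrows j hj.1 hj.2)
    · exact termRowsAt_of_eq (t₁ := Sect2.TermValues.zero) (t₂ := Sect2.TermValues.zero) (t₃ := Sect2.TermValues.zero)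
        (fun X z gc φ => hzE j hj X z gc φ) (fun X φ => hzR j hj X φ) (fun X φ a => hzB j hj X φ a) (termRowsAt_zero j) (termRowsAt_zero j) (termRowsAt_zero j)
  -- the operand of `t₀` is the operand of the truncation
  rw [← sect2Operand_congr_of_agree_pos (settingOfRecord₁₃ F N θ.toStage13Params p) (θ.rzAt p s.init) s.init hagE hagR hagB E₀
    (UbgOfRecord₁₃CoP F N θ.toStage13Params p k s.init)]
  -- one bound per row family, uniform over the levels (zero above `k`)
  have hbE : ∃ CE : ℝ, ∀ (j : ℕ) (X : (Sect2.domSys (F.P p.K) θ.τ9.M j).Dom) (z : Site (F.P p.K) j) (g' : ℝ) (U : GaugeField (F.P p.K) 0 (SU N)),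
      |(tr.E j X z g' (Sect2.ofBackgroundC (settingOfRecord₁₃ F N θ.toStage13Params p).ι U)).re| ≤ CE := by
    obtain ⟨C, hC⟩ := exists_uniform_bound
      (X := fun j => (Sect2.domSys (F.P p.K) θ.τ9.M j).Dom × Site (F.P p.K) j × ℝ × GaugeField (F.P p.K) 0 (SU N))
      (f := fun j x => (tr.E j x.1 x.2.1 x.2.2.1 (Sect2.ofBackgroundC (settingOfRecord₁₃ F N θ.toStage13Params p).ι x.2.2.2)).re) k
      (fun j => by obtain ⟨C, hC⟩ := (htrows j).2.1; exact ⟨C, fun x => hC x.1 x.2.1 x.2.2.1 x.2.2.2⟩)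
      (fun j hj x => by
        have h : ¬ (1 ≤ j ∧ j ≤ k) := fun h => absurd h.2 (not_le.mpr hj)
        simp only [hzE j h, Complex.zero_re])
    exact ⟨C, fun j X z g' U => hC j (X, z, g', U)⟩
  have hbR : ∃ CR : ℝ, ∀ (j : ℕ) (X : (Sect2.domSys (F.P p.K) θ.τ9.M j).Dom) (U : GaugeField (F.P p.K) 0 (SU N)),
      |(tr.R j X (Sect2.ofBackgroundC (settingOfRecord₁₃ F N θ.toStage13Params p).ι U)).re| ≤ CR := by
    obtain ⟨C, hC⟩ := exists_uniform_bound
      (X := fun j => (Sect2.domSys (F.P p.K) θ.τ9.M j).Dom × GaugeField (F.P p.K) 0 (SU N))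
      (f := fun j x => (tr.R j x.1 (Sect2.ofBackgroundC (settingOfRecord₁₃ F N θ.toStage13Params p).ι x.2)).re) k
      (fun j => by obtain ⟨C, hC⟩ := (htrows j).2.2.2.1; exact ⟨C, fun x => hC x.1 x.2⟩)
      (fun j hj x => by
        have h : ¬ (1 ≤ j ∧ j ≤ k) := fun h => absurd h.2 (not_le.mpr hj)
        simp only [hzR j h, Complex.zero_re])
    exact ⟨C, fun j X U => hC j (X, U)⟩
  have hbB : ∃ CB : ℝ, ∀ (j : ℕ) (X : (Sect2.domSys (F.P p.K) θ.τ9.M j).Dom) (U : GaugeField (F.P p.K) 0 (SU N)) (a : Tk.SFluct (F.P p.K) (FluctV N)),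
      |(tr.B j X (Sect2.ofBackgroundC (settingOfRecord₁₃ F N θ.toStage13Params p).ι U) a).re| ≤ CB := by
    obtain ⟨C, hC⟩ := exists_uniform_bound
      (X := fun j => (Sect2.domSys (F.P p.K) θ.τ9.M j).Dom × GaugeField (F.P p.K) 0 (SU N) × Tk.SFluct (F.P p.K) (FluctV N))
      (f := fun j x => (tr.B j x.1 (Sect2.ofBackgroundC (settingOfRecord₁₃ F N θ.toStage13Params p).ι x.2.1) x.2.2).re) k
      (fun j => by obtain ⟨C, hC⟩ := (htrows j).2.2.2.2.2; exact ⟨C, fun x => hC x.1 x.2.1 x.2.2⟩)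
      (fun j hj x => by
        have h : ¬ (1 ≤ j ∧ j ≤ k) := fun h => absurd h.2 (not_le.mpr hj)
        simp only [hzB j h, Complex.zero_re])
    exact ⟨C, fun j X U a => hC j (X, U, a)⟩
  exact ⟨measurable_sect2Operand_of_termRows p.K _ _ s.init tr E₀ (measurable_UbgOfRecord₁₃CoP F N θ.toStage13Params p k s.init) S
      (fun j X z g' => (htrows j).1 X z g') (fun j X => (htrows j).2.2.1 X) (fun j X => (htrows j).2.2.2.2.1 S X),
    exists_bound_sect2Operand_of_termBounds p.K _ _ s.init tr E₀ _ hbE hbR hbB⟩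

variable {θ p}

/-- **★★★ def-T's OPERAND ROWS ALONG THE CHAIN FROM THE SUPPLIER's TERM ROWS** — `SupplierTermRows θ p σ → OperandRowsAlongChain θ p σ` (§4's rows of the chain witness at the
levels `1 … k`, §5's first theorem at `init s′`; `k < K`, the inductive form and the presence of the parent are not even read). [cite: Balaban1988Convergent, (2.20)–(2.23) p.258, (3.16)–(3.21) pp.268–269, (3.24) p.270] -/
theorem operandRowsAlongChain_of_supplierTermRows {σ : Sect3Supplier θ p} (hσ : SupplierTermRows θ p σ) : OperandRowsAlongChain θ p σ :=
  fun k _ _ s _ _ => operandRowsAt_of_termRows θ p k s _ _ fun j h1 hj => termRowsAt_chainWitness_of_supplierTermRows hσ k s.init j h1 hj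

/-- **A6 — `SupplierTermRows` IS INHABITED: the zero supplier** (dag-n11-e's `zeroSupplier`, every response `Sect2.TermValues.zero`). [cite: Balaban1988Convergent, Thm 1 p.262 (bookkeeping)] -/
theorem supplierTermRows_zeroSupplier : SupplierTermRows θ p (zeroSupplier θ p) := fun k s j _ => by
  rw [zeroSupplier_fst k (chainWitness θ p (zeroSupplier θ p) k).1 (chainWitness θ p (zeroSupplier θ p) k).2 s]
  exact termRowsAt_zero j

end Operand

/-! ## §6. Theorem 1 of [III] with the operand rows discharged from the supplier's term rows -/

section Theorem1

variable {θ : Stage13HParams F N} {p : B12.RunParams}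

/-- **★★★ THEOREM 1 OF [III] AT `θ`, ALL LEVELS — `∀ k ≤ K, SLaw₁₃CoPH θ p k` — FROM `SupplierObligations θ p σ`, THE WITNESS-FREE `ResidualRows θ p` AND THE SUPPLIER's OWN TERM ROWS
`SupplierTermRows θ p σ`**, on the live-selector line (core provisos, `ZhUnity`, selector clause, admissibility, `0 ≤ κ, E₀, B₀`, `1 ≤ M`): dag-n11-e's
`sLaw₁₃CoPH_all_of_obligations_of_rows` with def-T's operand rows DISCHARGED by §5.  EVERYTHING on the supplier's side is now a property of its own constructed terms.
[cite: Balaban1988Convergent, Thm 1 p.262, Theorem p.245, Thm 2 p.263, §3 p.279, (3.24)–(3.25) p.270, (3.16)–(3.21) pp.268–269; Balaban1989LargeFieldI, (0.2)–(0.4) p.176, p.177 (i)–(ii)] -/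
theorem sLaw₁₃CoPH_all_of_obligations_of_residualRows_of_supplierTermRows (h : θ.Provisos₁₃CoPH F N) (hU : θ.ZhUnity F N)
    (hsel : θ.ppSel = ppSelLiveOfRecord F N θ.ν θ.τ9 (EOfRecord₁₃ F N θ.toStage13Params) (wOfRecord₉ F N θ.toStage9Params))
    (hθ : θ.Admissible F N) (hκ : 0 ≤ θ.s2.lf.κ) (hE₀ : 0 ≤ θ.s2.lf.E₀) (hB₀ : 0 ≤ θ.s2.lf.B₀) (hM : 1 ≤ θ.τ9.M) (σ : Sect3Supplier θ p)
    (hσ : SupplierObligations θ p σ) (hres : ResidualRows θ p) (hσr : SupplierTermRows θ p σ) : ∀ k, k ≤ p.K → SLaw₁₃CoPH F N θ p k :=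
  sLaw₁₃CoPH_all_of_obligations_of_rows h hU hsel hθ hκ hE₀ hB₀ hM σ hσ hres (operandRowsAlongChain_of_supplierTermRows hσr)

/-- **★★ THEOREM 1 OF [III] AT ANY `θ` OF THE GAUSSIAN-CERTIFICATE CLASS FROM `SupplierObligations` AND `SupplierTermRows` — NOTHING of the no-expansion lane** (certificate `ζ0`,
A-fibre Gaussian `quad`; live-selector line): dag-n11-e's `sLaw₁₃CoPH_all_of_obligations_of_gaussCert` with the operand rows DISCHARGED by §5.
[cite: Balaban1988Convergent, Thm 1 p.262, Theorem p.245, (3.24)–(3.25) p.270, (3.23) p.270, (2.23) p.258; Balaban1989LargeFieldI, (0.2)–(0.4) p.176, p.177 (i)–(ii)] -/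
theorem sLaw₁₃CoPH_all_of_obligations_of_gaussCert_of_supplierTermRows
    (hζ : ∀ (p : B12.RunParams) (n : ℕ) (Ω Λ : ℕ → Set (Site (F.P p.K) 0)), (θ.Zh p n Ω Λ).ζ0 = (ZhPinOfRecord₁₃ θ.toStage13Params p Ω Λ).ζ0)
    (hq : ∀ (p : B12.RunParams) (n : ℕ) (Ω Λ : ℕ → Set (Site (F.P p.K) 0)) (j : ℕ) (Λ' : Set (Site (F.P p.K) 0)) (ω : MultiCfg (F.P p.K) (SU N) (FluctV N)),
      (θ.Zh p n Ω Λ).quad j Λ' ω = ∑ b ∈ (Set.toFinite (bondsIn j (Λ'ᶜ ∩ Ω (j + 1)))).toFinset, ‖(ω j).2 b‖ ^ 2)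
    (h : θ.Provisos₁₃CoPH F N)
    (hsel : θ.ppSel = ppSelLiveOfRecord F N θ.ν θ.τ9 (EOfRecord₁₃ F N θ.toStage13Params) (wOfRecord₉ F N θ.toStage9Params))
    (hθ : θ.Admissible F N) (hκ : 0 ≤ θ.s2.lf.κ) (hE₀ : 0 ≤ θ.s2.lf.E₀) (hB₀ : 0 ≤ θ.s2.lf.B₀) (hM : 1 ≤ θ.τ9.M) (σ : Sect3Supplier θ p)
    (hσ : SupplierObligations θ p σ) (hσr : SupplierTermRows θ p σ) : ∀ k, k ≤ p.K → SLaw₁₃CoPH F N θ p k :=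
  sLaw₁₃CoPH_all_of_obligations_of_gaussCert hζ hq h hsel hθ hκ hE₀ hB₀ hM σ hσ (operandRowsAlongChain_of_supplierTermRows hσr)

/-- **★★★ THE GENERIC-`θ` TWIN UNDER THE 𝐑-SIDE TOKEN**: Theorem 1 of [III] at `θ` from `SupplierObligations`, `ResidualRows`, `SupplierTermRows` and `RStepW θ p` — core provisos and
`ZhUnity` are the residual rows' keys, `1 ≤ M`, `0 ≤ B₀`; NO selector clause, NO admissibility, NO `κ ∕ E₀` sign (this seat's p597488 `RStepW.sLaw₁₃CoPH_all_of_obligations_of_rows`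
over §5). [cite: Balaban1988Convergent, Thm 1 p.262, Theorem p.245, p.244 L36–38, (3.24)–(3.25) p.270, (3.16)–(3.21) pp.268–269; Balaban1989LargeFieldI, (0.2)–(0.3) p.176] -/
theorem _root_.Summit.QuantumFields.YangMills.Theorems.BalabanUVNodesN11RStepWitnessDefs.RStepW.sLaw₁₃CoPH_all_of_obligations_of_residualRows_of_supplierTermRows
    (hR : RStepW θ p) (h : θ.Provisos₁₃CoPH F N) (hU : θ.ZhUnity F N) (hM : 1 ≤ θ.τ9.M) (hB₀ : 0 ≤ θ.s2.lf.B₀) (σ : Sect3Supplier θ p)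
    (hσ : SupplierObligations θ p σ) (hres : ResidualRows θ p) (hσr : SupplierTermRows θ p σ) : ∀ k, k ≤ p.K → SLaw₁₃CoPH F N θ p k :=
  hR.sLaw₁₃CoPH_all_of_obligations_of_rows h hU hM hB₀ σ hσ hres (operandRowsAlongChain_of_supplierTermRows hσr)

/-- **★★ THE GENERIC-`θ` GAUSSIAN-CLASS TWIN UNDER THE 𝐑-SIDE TOKEN**: Theorem 1 of [III] at any Gaussian-class `θ` from `SupplierObligations`, `SupplierTermRows` and `RStepW θ p` —
core provisos, `1 ≤ M`, `0 ≤ B₀`; nothing of the no-expansion lane, nothing of the live-selector line (p597488 `RStepW.sLaw₁₃CoPH_all_of_obligations_of_gaussCert` over §5).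
[cite: Balaban1988Convergent, Thm 1 p.262, Theorem p.245, p.244 L36–38, (3.24)–(3.25) p.270, (3.23) p.270, (2.23) p.258] -/
theorem _root_.Summit.QuantumFields.YangMills.Theorems.BalabanUVNodesN11RStepWitnessDefs.RStepW.sLaw₁₃CoPH_all_of_obligations_of_gaussCert_of_supplierTermRows
    (hR : RStepW θ p)
    (hζ : ∀ (p : B12.RunParams) (n : ℕ) (Ω Λ : ℕ → Set (Site (F.P p.K) 0)), (θ.Zh p n Ω Λ).ζ0 = (ZhPinOfRecord₁₃ θ.toStage13Params p Ω Λ).ζ0)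
    (hq : ∀ (p : B12.RunParams) (n : ℕ) (Ω Λ : ℕ → Set (Site (F.P p.K) 0)) (j : ℕ) (Λ' : Set (Site (F.P p.K) 0)) (ω : MultiCfg (F.P p.K) (SU N) (FluctV N)),
      (θ.Zh p n Ω Λ).quad j Λ' ω = ∑ b ∈ (Set.toFinite (bondsIn j (Λ'ᶜ ∩ Ω (j + 1)))).toFinset, ‖(ω j).2 b‖ ^ 2)
    (h : θ.Provisos₁₃CoPH F N) (hM : 1 ≤ θ.τ9.M) (hB₀ : 0 ≤ θ.s2.lf.B₀) (σ : Sect3Supplier θ p) (hσ : SupplierObligations θ p σ) (hσr : SupplierTermRows θ p σ) :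
    ∀ k, k ≤ p.K → SLaw₁₃CoPH F N θ p k :=
  hR.sLaw₁₃CoPH_all_of_obligations_of_gaussCert hζ hq h hM hB₀ σ hσ (operandRowsAlongChain_of_supplierTermRows hσr)

end Theorem1

end Summit.QuantumFields.YangMills.Theorems.BalabanUVNodesN11Sect3SupplyChainTermRows

end
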